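import Summits.RiemannHypothesis.RiemannHypothesis.Theorems.WeilColumnThetaPRBracket
import Summits.RiemannHypothesis.RiemannHypothesis.Theorems.WeilColumnThetaPRStep6Limit
import Summits.RiemannHypothesis.RiemannHypothesis.Theorems.WeilColumnThetaAtomMollified
import Summits.RiemannHypothesis.RiemannHypothesis.Theorems.WeilColumnThetaMainTermLevelKFree
import Summits.RiemannHypothesis.RiemannHypothesis.Theorems.WeilColumnThetaTruncatedDerivNorm
import Summits.RiemannHypothesis.RiemannHypothesis.Theorems.WeilColumnThetaMajorantD2
import Summits.RiemannHypothesis.RiemannHypothesis.Theorems.WeilColumnThetaGain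
import Summits.RiemannHypothesis.RiemannHypothesis.Theorems.WeilColumnThetaPRStep2GRDecay
import HarnessLib

/-!
# THETA kernel certificate: the analytic theorem (AN) — `loss t₀ < gain J` ⇒ `a*(S_q) < (log q⁺)/2` (RH-FREE)

Cell `rh-explicit`, WEIL column, seat weil-1 gen19 (director-rh g5 2026-08-26T08:35Z: weil-1 = default writer of the FINAL assembly;
THETA-ASSIGN v1.0/1.1 §2 (AN), §6). For an admissible row `P : ThetaParams` (`WeilColumnThetaWitness`) with consecutive primes
`q < q⁺`, the mollified odd cut witness `φ_k = g⁻ ⋆ moll_k` lives in the window `[−(log q⁺)/2, (log q⁺)/2]` for large `k`, and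

  `Re Q_{S_q}(φ_k) ≤ Re Q(φ_k) − 2 log q·I + atom + e`            (D4, `WeilColumnThetaAtomMollified`),
  `Re Q(φ_k) ≤ Re Q(TR_k) + β(R)`, `β → 0`                          (Steps 0–4: `WeilColumnThetaPRBracket`, given Step 2's decay of `GR_k`),
  `Re Q(TR_k) ≤ levelK(k) + arch(P.A, B′_R)`                        (Step 5′: handoff-prove-2's `re_weilQuadratic_moll_oddTail_le'` on
                                                                      `f = T_R⁻`, `A′ = P.A` by `integral_norm_sq_TROdd_le`, and the SHIFTED
                                                                      `B′_R = ∫‖(T_R⁻)′‖² + (P.B − ∫‖(T⁻)′‖²) → P.B` by `tendsto_integral_norm_sq_deriv_TROdd`),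
  `levelK(k) → primesC + cross`, `arch(P.A, B′_R) → P.arch t₀`       (Step 6: `WeilColumnThetaPRStep6Limit`),

so `Re Q(φ_k) ≤ primesC + cross + arch t₀ + e` eventually, and `loss t₀ < gain J ≤ 2 log q·I` closes:
**`uc_of_loss_lt_gain_of_GRdecay`** — UC(q) from `P.Admissible qn`, `ConsecutivePrimes q qn`, the Rosser–Schoenfeld bound
`ψ(x) ≤ 1.03883·x` (hypothesis, by name of its constant `rsConst`), `loss t₀ < gain J`, and the Step-2 decay of `GR_k`
(cc-s2-3's `WeilColumnThetaPRStep2GRDecay`, first as a hypothesis in the shape of `exists_bracket_tendsto_zero`), and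
**`uc_of_loss_lt_gain`** — the same with Step 2 plugged in (`norm_weilMellin_GROdd_moll_le`): (AN) of THETA-ASSIGN.
Upper-clause bookkeeping only; nothing here bears on the truth of RH.
-/

noncomputable section

set_option linter.dupNamespace false

open Complex Set MeasureTheory Filter
open scoped Real Topology ComplexConjugate Chebyshev

namespace Summit.RiemannHypothesis.RiemannHypothesis.Theorems.WeilColumn.ThetaMellin

open Literature.NumberTheory.LFunctions Literature.NumberTheory.LFunctions.WeilContinuous ThetaParams

namespace ThetaParams

variable {P : ThetaParams}

/-! ## §1 The truncated tail `T_R` as an input of Step 5′ -/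

/-- `2 ≤ m` for an admissible row. -/
private theorem two_le_m₅ {qn : ℕ} (hP : P.Admissible qn) : 2 ≤ P.m := le_trans (by norm_num) hP.three_le

/-- `T_R = 0` strictly above `x₁`. [folklore] -/
theorem TR_eq_zero_of_gt {qn : ℕ} (hP : P.Admissible qn) (R : ℝ) {u : ℝ} (hu : P.x₁ < u) : P.TR R u = 0 :=
  TR_eq_zero_of_ge hP R hu.le

/-- **The envelope of `T_R`**: `‖T_R(u)‖ ≤ M√u₁·e^{(m+½)(u−x₁)}` for every `u` (D1 + the cut `χ̃_R ∈ [0,1]`; `= 0` above `x₁`).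
[THETA-CERT-cc6 §D3 (★)] -/
theorem norm_TR_le {qn : ℕ} (hP : P.Admissible qn) (R u : ℝ) :
    ‖P.TR R u‖ ≤ P.M * Real.sqrt P.u₁ * Real.exp (((P.m : ℝ) + 1 / 2) * (u - P.x₁)) := by
  by_cases hu : u ≤ P.x₁
  · rw [P.TR_eq_tail R u, ← ThetaTail.envelope_eq (M := P.M) (m := P.m) (rfl : P.u₁ = Real.exp P.x₁) u]
    exact ThetaTail.norm_tail_le (rfl : P.u₁ = Real.exp P.x₁) (fun v hv ↦ P.norm_Θ_le' hP hv.1)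
      (truncCut_cut_mem_Icc hP R) hu
  · rw [TR_eq_zero_of_gt hP R (not_le.1 hu), norm_zero]
    have : 0 ≤ P.M := by
      have h := le_trans (norm_nonneg _) (P.norm_Θ_le' hP Real.zero_lt_one)
      have hc : 0 < (1 / P.u₁) ^ P.m := by have : 0 < P.u₁ := Real.exp_pos _; positivity
      exact le_of_mul_le_mul_right (by rwa [zero_mul]) hc
    positivity

/-- `tsupport T_R⁻ ⊆ [−(R+1), R+1]` for `R ≥ 0`. [folklore] -/
theorem tsupport_TROdd_subset {qn : ℕ} (hP : P.Admissible qn) {R : ℝ} (hR : 0 ≤ R) :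
    tsupport (P.TROdd R) ⊆ Icc (-(R + 1)) (R + 1) := by
  have hx₁ : P.x₁ < 0 := P.x₁_neg hP
  refine closure_minimal (fun x hx ↦ ?_) isClosed_Icc
  rw [Function.mem_support] at hx
  by_contra h
  rw [mem_Icc, not_and_or, not_le, not_le] at h
  apply hx
  show P.TR R x - P.TR R (-x) = 0
  rcases h with h | h
  · rw [P.TR_eq_zero_of_le (R := R) (by linarith), TR_eq_zero_of_ge hP R (by linarith), sub_zero]
  · rw [TR_eq_zero_of_ge hP R (by linarith), P.TR_eq_zero_of_le (R := R) (by linarith), sub_zero]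

/-- `u ↦ Θ(eᵘ)` is continuous (`Θ(eᵘ) = e^{−u/2}·G₀(u)`). [folklore] -/
theorem continuous_Θ_comp_exp {qn : ℕ} (hP : P.Admissible qn) : Continuous fun x : ℝ ↦ P.Θ (Real.exp x) := by
  have e : (fun x : ℝ ↦ P.Θ (Real.exp x)) = fun x ↦ (Real.exp (-(x / 2)) : ℂ) * P.G₀ x := by
    funext x
    show P.Θ (Real.exp x) = (Real.exp (-(x / 2)) : ℂ) * ((Real.exp (x / 2) : ℂ) * P.Θ (Real.exp x))
    rw [← mul_assoc, ← Complex.ofReal_mul, ← Real.exp_add, neg_add_cancel, Real.exp_zero, Complex.ofReal_one, one_mul]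
  rw [e]
  exact (Complex.continuous_ofReal.comp (Real.continuous_exp.comp (continuous_id.div_const 2).neg)).mul (continuous_G₀ hP)

/-- **`T_R⁻` is `C¹`** (explicit derivative `hasDerivAt_TROdd` of handoff-prove-2, continuous by D2's `continuousOn_deriv_Θ`). [folklore] -/
theorem contDiff_one_TROdd {qn : ℕ} (hP : P.Admissible qn) (R : ℝ) : ContDiff ℝ 1 (P.TROdd R) := by
  have hΘ' : ∀ u : ℝ, 0 < u → HasDerivAt P.Θ (deriv P.Θ u) u := fun u hu ↦ P.hasDerivAt_deriv_Θ hP hu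
  set B : ℝ → ℂ := fun x ↦
    (Real.exp (x / 2) : ℂ) * ((1 / 2 : ℂ) * P.Θ (Real.exp x) + (Real.exp x : ℂ) * deriv P.Θ (Real.exp x)) *
        (((1 - truncCut (smoothStep R) P.cut x : ℝ)) : ℂ) -
      (Real.exp (x / 2) : ℂ) * P.Θ (Real.exp x) *
        ((-(deriv Real.smoothTransition (x + R + 1) * (1 - P.cut x)) + smoothStep R x *
          (bsplineDensity (P.η / (2 * P.m)) (P.m - 1) (x + P.a - P.η / 2)).re : ℝ) : ℂ) with hB
  have hd : ∀ x, HasDerivAt (P.TROdd R) (B x + B (-x)) x := fun x ↦ P.hasDerivAt_TROdd hP hΘ' R x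
  -- continuity of `B`
  have c1 : Continuous fun x : ℝ ↦ (Real.exp (x / 2) : ℂ) :=
    Complex.continuous_ofReal.comp (Real.continuous_exp.comp (continuous_id.div_const 2))
  have c2 : Continuous fun x : ℝ ↦ P.Θ (Real.exp x) := continuous_Θ_comp_exp hP
  have c3 : Continuous fun x : ℝ ↦ deriv P.Θ (Real.exp x) :=
    (P.continuousOn_deriv_Θ hP).comp_continuous Real.continuous_exp fun x ↦ Real.exp_pos x
  have c4 : Continuous fun x : ℝ ↦ (Real.exp x : ℂ) := Complex.continuous_ofReal.comp Real.continuous_exp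
  have c5 : Continuous fun x : ℝ ↦ (((1 - truncCut (smoothStep R) P.cut x : ℝ)) : ℂ) :=
    Complex.continuous_ofReal.comp (continuous_const.sub
      (continuous_iff_continuousAt.2 fun x ↦ (hasDerivAt_truncCut_cut hP R x).continuousAt))
  have c6 : Continuous fun x : ℝ ↦ ((-(deriv Real.smoothTransition (x + R + 1) * (1 - P.cut x)) + smoothStep R x *
      (bsplineDensity (P.η / (2 * P.m)) (P.m - 1) (x + P.a - P.η / 2)).re : ℝ) : ℂ) :=
    Complex.continuous_ofReal.comp (continuous_deriv_truncCut_cut hP R)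
  have hBc : Continuous B := by
    rw [hB]
    exact ((c1.mul ((continuous_const.mul c2).add (c4.mul c3))).mul c5).sub ((c1.mul c2).mul c6)
  have hderiv : deriv (P.TROdd R) = fun x ↦ B x + B (-x) := funext fun x ↦ (hd x).deriv
  rw [contDiff_one_iff_deriv]
  exact ⟨fun x ↦ (hd x).differentiableAt, by rw [hderiv]; exact hBc.add (hBc.comp continuous_neg)⟩

/-! ## §2 Step 5′ on `f = T_R⁻` with the shifted `B′_R` -/

/-- **STEP 5′ FOR THE TRUNCATED TAIL**: for `R ≥ 0`, `0 < t₀ ≤ 1`, the RS bound, and `k` with `x₁ + 1/(k+1) < 0`,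
`Re Q(TR_k) ≤ levelK(k) + (B′_R/2·e^{t₀/2}·t₀²/2 + P.A·max 0 (2·Jexplicit t₀ − log 4π − γ − C₁))` with the SHIFTED
`B′_R := ∫‖(T_R⁻)′‖² + (P.B − ∫‖(T⁻)′‖²)` (`≥ ∫‖(T_R⁻)′‖²` by `integral_norm_sq_deriv_TOdd_le`, `→ P.B` as `R → ∞`). [THETA-ASSIGN v1.1 §6 Step 5] -/
theorem re_weilQuadratic_TRk_le {qn : ℕ} (hP : P.Admissible qn) (hRS : ∀ x : ℝ, 0 ≤ x → ψ x ≤ rsConst * x)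
    {t₀ : ℝ} (ht₀ : 0 < t₀) (ht₁ : t₀ ≤ 1) {R : ℝ} (hR : 0 ≤ R) (k : ℕ) (hk : P.x₁ + 1 / ((k : ℝ) + 1) < 0) :
    (weilQuadratic (weilConv (P.TROdd R) (moll k))).re ≤
      2 * (P.M * Real.sqrt P.u₁ * Real.exp ((2 * P.m + 1) / ((k : ℝ) + 1))) ^ 2 / ((P.m : ℝ) + 1 / 2) *
            vonMangoldtSum (P.m + 1) +
          2 * (P.M * Real.sqrt P.u₁ * Real.exp ((2 * P.m + 1) / ((k : ℝ) + 1))) ^ 2 *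
            Real.sqrt (Real.exp (-2 * (P.x₁ + 1 / ((k : ℝ) + 1)))) *
            (rsConst * (Real.exp (-((P.m : ℝ) / ((P.m : ℝ) + 1))) / ((P.m : ℝ) + 1) + 1 / (P.m : ℝ) ^ 2)) +
        (((∫ x, ‖deriv (P.TROdd R) x‖ ^ 2) + (P.B - ∫ x, ‖deriv P.TOdd x‖ ^ 2)) / 2 * Real.exp (t₀ / 2) * t₀ ^ 2 / 2 +
          P.A * max 0 (2 * Jexplicit t₀ - Real.log (4 * π) - Real.eulerMascheroniConstant - archC₁)) := by
  have hΘ' : ∀ u : ℝ, 0 < u → HasDerivAt P.Θ (deriv P.Θ u) u := fun u hu ↦ P.hasDerivAt_deriv_Θ hP hu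
  have hM₁ := P.D2_on_Ioc hP
  have hM0 : 0 ≤ P.M * Real.sqrt P.u₁ := by
    have h := le_trans (norm_nonneg _) (P.norm_Θ_le' hP Real.zero_lt_one)
    have hc : 0 < (1 / P.u₁) ^ P.m := by have : 0 < P.u₁ := Real.exp_pos _; positivity
    have : 0 ≤ P.M := le_of_mul_le_mul_right (by rwa [zero_mul]) hc
    positivity
  have hBtot : ∫ x, ‖deriv (P.TROdd R) x‖ ^ 2 ≤ (∫ x, ‖deriv (P.TROdd R) x‖ ^ 2) + (P.B - ∫ x, ‖deriv P.TOdd x‖ ^ 2) := by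
    have := P.integral_norm_sq_deriv_TOdd_le hP hΘ' hM₁
    linarith
  have hrs : (0 : ℝ) ≤ rsConst := by unfold rsConst; norm_num
  exact P.re_weilQuadratic_moll_oddTail_le' hP (T := P.TR R) (continuous_TR hP R) (fun u hu ↦ TR_eq_zero_of_gt hP R hu)
    hM0 (fun u ↦ norm_TR_le hP R u) (fun u ↦ rfl) (contDiff_one_TROdd hP R) (hasCompactSupport_TROdd hP R)
    (tsupport_TROdd_subset hP hR) (P.integral_norm_sq_TROdd_le hP R) hBtot ht₀ ht₁ hrs hRS k hk

/-! ## §3 The assembly -/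

/-- Eventually in `k`, `x₁ + 1/(k+1) < 0` (`x₁ < 0`). [folklore] -/
theorem eventually_x₁_add_lt_zero {qn : ℕ} (hP : P.Admissible qn) : ∀ᶠ k : ℕ in atTop, P.x₁ + 1 / ((k : ℝ) + 1) < 0 := by
  have hx₁ : P.x₁ < 0 := P.x₁_neg hP
  have h0 : Tendsto (fun k : ℕ ↦ 1 / ((k : ℝ) + 1)) atTop (𝓝 0) := tendsto_one_div_add_atTop_nhds_zero_nat
  filter_upwards [(tendsto_order.1 h0).2 (-P.x₁) (by linarith)] with k hk
  linarith

/-- The shifted `B′_R/2·e^{t₀/2}·t₀²/2 + P.A·max 0 (…)` tends to `P.arch t₀` as `R → ∞`. [folklore] -/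
theorem tendsto_archR {qn : ℕ} (hP : P.Admissible qn) (t₀ : ℝ) :
    Tendsto (fun R : ℝ ↦ ((∫ x, ‖deriv (P.TROdd R) x‖ ^ 2) + (P.B - ∫ x, ‖deriv P.TOdd x‖ ^ 2)) / 2 * Real.exp (t₀ / 2) *
        t₀ ^ 2 / 2 + P.A * max 0 (2 * Jexplicit t₀ - Real.log (4 * π) - Real.eulerMascheroniConstant - archC₁))
      atTop (𝓝 (P.arch t₀)) := by
  have hΘ' : ∀ u : ℝ, 0 < u → HasDerivAt P.Θ (deriv P.Θ u) u := fun u hu ↦ P.hasDerivAt_deriv_Θ hP hu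
  have hlim := P.tendsto_integral_norm_sq_deriv_TROdd hP hΘ' (P.D2_on_Ioc hP)
  have hB : Tendsto (fun R : ℝ ↦ (∫ x, ‖deriv (P.TROdd R) x‖ ^ 2) + (P.B - ∫ x, ‖deriv P.TOdd x‖ ^ 2)) atTop (𝓝 P.B) := by
    have h := hlim.add_const (P.B - ∫ x, ‖deriv P.TOdd x‖ ^ 2)
    rw [add_sub_cancel] at h
    exact h
  rw [P.arch_eq_bracket t₀]
  exact (((hB.div_const 2).mul_const _).mul_const _ |>.div_const 2).add_const _

/-- **(AN), MODULO STEP 2.** For an admissible row with consecutive primes `q < q⁺`, the Rosser–Schoenfeld bound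
`ψ(x) ≤ rsConst·x`, `0 < t₀ ≤ 1`, `0 < J` and the certificate inequality `loss t₀ < gain J`: IF the mollified truncated profile
decays on the zero side uniformly in `k` with a constant `W_G(R) → 0` (Step 2, cc-s2-3's `WeilColumnThetaPRStep2GRDecay`), THEN
`a*(S_q) < (log q⁺)/2`. [THETA-ASSIGN v1.0 §2 (AN); RH-FREE] -/
theorem uc_of_loss_lt_gain_of_GRdecay {qn : ℕ} (hP : P.Admissible qn) (hcons : Handoff.ConsecutivePrimes P.q qn)
    (hRS : ∀ x : ℝ, 0 ≤ x → ψ x ≤ rsConst * x) {t₀ : ℝ} (ht₀ : 0 < t₀) (ht₁ : t₀ ≤ 1) {J : ℕ} (hJ : 0 < J)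
    (hlg : P.loss t₀ < P.gain J)
    {WG : ℝ → ℝ} {R₁ : ℝ} (hWG0 : ∀ R, R₁ ≤ R → 0 ≤ WG R) (hWGlim : Tendsto WG atTop (𝓝 0))
    (hG : ∀ R : ℝ, R₁ ≤ R → ∀ k : ℕ, ∀ ρ : ℂ, ρ ∈ RHWave0.riemannZetaNontrivialZeros →
      ‖weilMellin (weilConv (P.GROdd R) (moll k)) ρ‖ ≤ WG R / ‖ρ - 1 / 2‖) :
    MotivicDoor.SemilocalThreshold.weilSemilocalThreshold (Nat.primesBelow P.q) < Real.log qn / 2 := by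
  have hq2 : 2 ≤ P.q := hcons.1.two_le
  have hq1 : 1 ≤ P.q := le_trans (by norm_num) hq2
  have hΘ' : ∀ u : ℝ, 0 < u → HasDerivAt P.Θ (deriv P.Θ u) u := fun u hu ↦ P.hasDerivAt_deriv_Θ hP hu
  -- Steps 0–4: the bracket `β(R) → 0`
  obtain ⟨β, hβ, hbr⟩ := exists_bracket_tendsto_zero hP hΘ' (P.continuousOn_deriv_Θ hP) (P.D2_on_Ioc hP) hWG0 hWGlim hG
  -- Steps 1–5 together, eventually in `k`, for every `R ≥ R₀ := max (max a R₁) 0`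
  set R₀ : ℝ := max (max P.a R₁) 0 with hR₀
  have hsteps : ∀ᶠ k : ℕ in atTop, ∀ R : ℝ, R₀ ≤ R →
      (weilQuadratic (P.phi k)).re ≤
        (2 * (P.M * Real.sqrt P.u₁ * Real.exp ((2 * P.m + 1) / ((k : ℝ) + 1))) ^ 2 / ((P.m : ℝ) + 1 / 2) *
              vonMangoldtSum (P.m + 1) +
            2 * (P.M * Real.sqrt P.u₁ * Real.exp ((2 * P.m + 1) / ((k : ℝ) + 1))) ^ 2 *
              Real.sqrt (Real.exp (-2 * (P.x₁ + 1 / ((k : ℝ) + 1)))) *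
              (rsConst * (Real.exp (-((P.m : ℝ) / ((P.m : ℝ) + 1))) / ((P.m : ℝ) + 1) + 1 / (P.m : ℝ) ^ 2))) +
          (((∫ x, ‖deriv (P.TROdd R) x‖ ^ 2) + (P.B - ∫ x, ‖deriv P.TOdd x‖ ^ 2)) / 2 * Real.exp (t₀ / 2) * t₀ ^ 2 / 2 +
            P.A * max 0 (2 * Jexplicit t₀ - Real.log (4 * π) - Real.eulerMascheroniConstant - archC₁)) +
          β R := by
    filter_upwards [eventually_x₁_add_lt_zero hP] with k hk R hR
    have hR' : max P.a R₁ ≤ R := le_trans (le_max_left _ _) hR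
    have hR0 : 0 ≤ R := le_trans (le_max_right _ _) hR
    have h1 := hbr k R hR'
    have h2 := re_weilQuadratic_TRk_le hP hRS ht₀ ht₁ hR0 k hk
    linarith
  -- Step 6
  have hB : ∀ e : ℝ, 0 < e → ∀ᶠ k : ℕ in atTop,
      (weilQuadratic (P.phi k)).re ≤ P.primesC + P.cross + P.arch t₀ + e := fun e he ↦
    eventually_re_weilQuadratic_phi_le_of_steps hsteps (tendsto_levelK_witness P) (tendsto_archR hP t₀) hβ he
  -- the certificate inequality and the atom side
  have hlt := full_ceiling_lt hlg (P.gain_le hP.delta_pos (two_le_m₅ hP) hJ hq1)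
  exact weilSemilocalThreshold_lt_of_full_le hP hcons hB hlt


/-! ## §4 (AN): Step 2 plugged in -/

/-- `0 ≤ M` and `0 ≤ M₁` for an admissible row (D1 at `u = 1`, D2 at `u = u₁`). -/
private theorem M_M₁_nonneg {qn : ℕ} (hP : P.Admissible qn) : 0 ≤ P.M ∧ 0 ≤ P.M₁ := by
  have hu : 0 < P.u₁ := Real.exp_pos _
  refine ⟨?_, ?_⟩
  · have h := le_trans (norm_nonneg _) (P.norm_Θ_le' hP Real.zero_lt_one)
    have hc : 0 < (1 / P.u₁) ^ P.m := by positivity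
    exact le_of_mul_le_mul_right (by rwa [zero_mul]) hc
  · have h := le_trans (norm_nonneg _) (P.D2_on_Ioc hP P.u₁ ⟨hu, le_rfl⟩)
    rwa [div_self hu.ne', one_pow, mul_one] at h

/-- **(AN) — THE ANALYTIC THEOREM OF THE THETA KERNEL CERTIFICATE.** For an admissible row `P` with consecutive primes
`q < q⁺`, the Rosser–Schoenfeld bound `ψ(x) ≤ rsConst·x` (`x ≥ 0`), `0 < t₀ ≤ 1`, `0 < J` and the certificate inequality
`loss t₀ < gain J`, the upper clause holds: **`a*(S_q) < (log q⁺)/2`**. The Step-2 decay is cc-s2-3's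
`norm_weilMellin_GROdd_moll_le` (`W_G(R) = e^{1/2}·2·W_R`, `W_R = C·e^{−(m−1)R}/(m−1) → 0`). [THETA-ASSIGN v1.0 §2 (AN); RH-FREE] -/
theorem uc_of_loss_lt_gain {qn : ℕ} (hP : P.Admissible qn) (hcons : Handoff.ConsecutivePrimes P.q qn)
    (hRS : ∀ x : ℝ, 0 ≤ x → ψ x ≤ rsConst * x) {t₀ : ℝ} (ht₀ : 0 < t₀) (ht₁ : t₀ ≤ 1) {J : ℕ} (hJ : 0 < J)
    (hlg : P.loss t₀ < P.gain J) :
    MotivicDoor.SemilocalThreshold.weilSemilocalThreshold (Nat.primesBelow P.q) < Real.log qn / 2 := by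
  obtain ⟨Lψ, hL0, hL⟩ := exists_abs_deriv_smoothTransition_le
  have hΘ' : ∀ u : ℝ, 0 < u → HasDerivAt P.Θ (deriv P.Θ u) u := fun u hu ↦ P.hasDerivAt_deriv_Θ hP hu
  obtain ⟨hM, hM₁⟩ := M_M₁_nonneg hP
  have hu : 0 < P.u₁ := Real.exp_pos _
  have hm1 : (0 : ℝ) < ((P.m : ℝ) - 1 / 2) - 1 / 2 := by
    have : (3 : ℝ) ≤ P.m := by exact_mod_cast hP.three_le
    linarith
  have hC : 0 ≤ ((3 / 2 + Lψ) * P.M) / P.u₁ ^ P.m + P.M₁ / P.u₁ ^ (P.m - 1) := by positivity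
  -- `W_G(R) → 0`
  have hexp : Tendsto (fun R : ℝ ↦ Real.exp ((((P.m : ℝ) - 1 / 2) - 1 / 2) * (-R))) atTop (𝓝 0) := by
    have h1 : Tendsto (fun R : ℝ ↦ (((P.m : ℝ) - 1 / 2) - 1 / 2) * (-R)) atTop atBot :=
      tendsto_neg_atTop_atBot.const_mul_atBot hm1
    exact Real.tendsto_exp_atBot.comp h1
  have hWGlim : Tendsto (fun R : ℝ ↦ Real.exp (1 / 2) * (2 *
      ((((3 / 2 + Lψ) * P.M) / P.u₁ ^ P.m + P.M₁ / P.u₁ ^ (P.m - 1)) * Real.exp ((((P.m : ℝ) - 1 / 2) - 1 / 2) * (-R)) /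
        (((P.m : ℝ) - 1 / 2) - 1 / 2)))) atTop (𝓝 0) := by
    simpa using (((hexp.const_mul _).div_const (((P.m : ℝ) - 1 / 2) - 1 / 2)).const_mul 2).const_mul (Real.exp (1 / 2))
  refine uc_of_loss_lt_gain_of_GRdecay hP hcons hRS ht₀ ht₁ hJ hlg (R₁ := P.a)
    (WG := fun R : ℝ ↦ Real.exp (1 / 2) * (2 *
      ((((3 / 2 + Lψ) * P.M) / P.u₁ ^ P.m + P.M₁ / P.u₁ ^ (P.m - 1)) * Real.exp ((((P.m : ℝ) - 1 / 2) - 1 / 2) * (-R)) /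
        (((P.m : ℝ) - 1 / 2) - 1 / 2))))
    (fun R _ ↦ by positivity) hWGlim fun R hR k ρ hρ ↦ ?_
  exact P.norm_weilMellin_GROdd_moll_le hP hΘ' (P.continuousOn_deriv_Θ hP) (P.D2_on_Ioc hP) hL0 hL hR k hρ

end ThetaParams

end Summit.RiemannHypothesis.RiemannHypothesis.Theorems.WeilColumn.ThetaMellin

end
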